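/-
Copyright: the b2b-balaban T⁴-continuum CRUX team, row NE7b OWNER lineage `t4-ne7b-p1` (gen 122). Project licence.
-/
import Summits.QuantumFields.BalabanUV.T4Continuum.Spine.NE7b.SupTorusPerturbedColumns

/-!
# THE COARSE FLOOR AND THE NEXT-SCALE HESSIAN'S LOCALITY FOR THE PERTURBED HESSIAN `H + K` (`K` symmetric, `|K(x,z)| ≤ εe^{−γρ_N(x,z)}`):
# `⟨g, T_K g⟩ ≥ Σ g²∕(36^d(4d + a + Λ + εK_γ))` for every coarse `g` ((135)'s variational argument with the bump test function — the kernel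
# costs `εK_γ‖Φ‖²` by the Schur test at the zero weight), hence by [B4] Sect. 5 BY NAME ((132) `coarse_inverse_decay`) `|T_K⁻¹(y,y′)| ≤
# c₁e^{−δ₁ρ_s(y,y′)}` with `(c₁, δ₁)` from `(d, a, λ, Λ, ε, γ)` only — the next action's Hessian `(n+1)^d T_K⁻¹` is exponentially local for
# the class of Hessians the road's step produces: the locality column ITERATES (row NE7b, node U5c; (132)–(135)∕(162)–(165) BY NAME; [folklore])

Cell `pub-balaban`, sub-cell `t4`, spine estimate NE7b (`T4WeightBudget.RelWeightBound`; the cell's OWN estimate — NOT PRINTED in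
[Bałaban 1983–89], NOT PROVED).  Crux-route work under `Spine/NE7b/` by the row OWNER (`t4-ne7b-p1` gen 122, file (166)) under FREEZE
(0)'s crux-prover clause; NOTHING of Bałaban's is named as a Lean object, valued or asserted; no `T4Continuum/Support` leaf typed; no `def`,
no notation; zero `sorry`.  Imports (BY NAME): the OWNER's (165) `…SupTorusPerturbedColumns` (`perturbed_action_sub`, `perturbed_action_smul`,
`perturbed_form_symm`, `perturbed_schur_symm`, `perturbed_schur_entry_le`; through it (163) `rowsum_le`, `colsum_le`, (162)
`schur_test_weighted`, (135) §1 bump letters `sum_blockLift_mul_F`, `blockSum_F`, `sum_bond_sq_le`, `sum_F_sq_le`, (133) `action_sum_smul`,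
(132) `coarse_inverse_decay`, TDFC `torus_form_coercive_explicit`, (130) `torus_form_split`, TDF `sum_blockLift_mul`).

WHY (located).  (162)–(165) re-ran the resolvent letter, block locality, existence∕symmetry of the columns and the Schur entries for `H + K`;
the one remaining input of the next-scale locality is the COARSE FLOOR.  (135)'s proof is a variational inequality (floor of the form on
`Ψ − tΦ` ≥ 0 + symmetry) with the test function `Φ = g(bt ·)·bump`; the kernel enters twice, both through `|⟨u, Ku⟩| ≤ εK_γ‖u‖²` (Schur
test, zero weight): in the floor (`λ + εK_γ ≤ min(2,a)` keeps it nonnegative) and in `⟨Φ, (H+K)Φ⟩ ≤ (4d + a + Λ + εK_γ)(n+1)^dΣg²`.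

WHAT IS PROVED ([folklore]; fine torus `Site d ((n+1)s)`, coarse `Site d s`; `(H + K)u` DISPLAYED; `K_γ = (2∕(1 − e^{−γ}))^d`):
* §1 `kernel_form_le` (`Σ_z|K x z| ≤ r`, `Σ_x|K x z| ≤ r` ⟹ `|Σ_x u x·Σ_z K x z·u z| ≤ r·Σ u²`), `perturbed_action_sum_smul` (linearity over sums).
* §2 `perturbed_variational` (`V ≥ −λ`, `λ + r ≤ min(2,a)`, `K` symmetric with row∕column sums `≤ r`: `2tΣGΦ − t²ΣΦ·(H+K)Φ ≤ ΣGΨ` for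
  `(H+K)Ψ = G`).
* §3 **`perturbed_coarse_floor`** (`a > 0`, `−λ ≤ V ≤ Λ`, `Λ ≥ 0`, `|K| ≤ εe^{−γρ}` symmetric, `γ > 0`, `ε ≥ 0`, `λ + εK_γ ≤ min(2,a)`:
  `Σ g²∕(36^d(4d + a + Λ + εK_γ)) ≤ ⟨g, T_K g⟩` for EVERY coarse `g`).
* §4 THE HEADLINE **`perturbed_nextScale_hessian_local`**: `a > 0`, `λ < min(2,a)`, `Λ ≥ 0`, `γ > 1`, `ε ≥ 0` small enough that
  `εK_{γ−1} ≤ (min(2,a) − λ)∕4` ⟹ `∃ c₁ δ₁ > 0`: for ALL `n, s`, `−λ ≤ V ≤ Λ`, symmetric `K` with `|K| ≤ εe^{−γρ_N}` and its block columns,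
  `|T_K⁻¹(y,y′)| ≤ c₁e^{−δ₁ρ_s(y,y′)}`.
* §5 toy.

HONEST (what this is NOT).  The floor and `T_K⁻¹`'s decay; the next-scale operator, response, covariance, pointwise and volume letters for
`H + K` are the same by-name re-runs and are left to the successor; constants existential; cubic periods; scalar skeleton ((A3), NC-NE7b-α
UNRULED); nothing of Bałaban's.  BY-NAME EFFECT ON THE WALL: NONE.  NE7b NOT PRINTED ∕ NOT PROVED; spine PROVED 0∕9; rung (B)+1 on a FINITE
torus — NOT infinite volume, NOT the mass gap, NOT Clay.  HONEST DEPENDENCY: continuum YM on T⁴ ⇐ BetaPertH ∧ nine spine estimates (0∕9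
proved); BetaPertH ⇐ (D1) ∧ (D4) ∧ CAP+tail; G-an2-4 gates asym, D1 and NE2∕3∕4.
-/

set_option autoImplicit false

noncomputable section

namespace Summit.QuantumFields.BalabanUV.T4Continuum.NE7b.SupTorusPerturbedCoarseFloor

open Real
open Literature.MathematicalPhysics.QuantumFieldTheory.Balaban1983to89
open B6QGQLower276 (X e blk B side chart mem_B sum_B sum_B_const card_cube blk_chart F Theta1 Theta1_div_ge Theta1_div_le Theta1_nonneg)
open Beta (Site siteOf windowMap siteOf_windowMap siteOf_add)
open SupTorusDirichletForm (sum_blockLift_mul)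
open SupTorusConjugatedForm (torus_form_split)
open SupTorusDirichletFormCoercive (torus_form_coercive_explicit)
open SupTorusActionForm (action_sum_smul)
open SupTorusBlockDistance (coarse_inverse_decay)
open SupTorusHessianCombesThomas (exists_rate)
open SupTorusCoarseFloor (sum_blockLift_mul_F blockSum_F sum_bond_sq_le sum_F_sq_le)
open SupTorusPerturbedResolvent (schur_test_weighted)
open SupTorusPerturbedKernelSums (rowsum_le colsum_le)
open SupTorusPerturbedColumns (perturbed_action_sub perturbed_action_smul perturbed_form_symm perturbed_schur_symm perturbed_schur_entry_le)

variable {d : ℕ}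

/-! ## §1. The kernel's form and linearity over sums -/

/-- **THE KERNEL'S QUADRATIC FORM IS SMALL**: row and column sums `≤ r` ⟹ `|Σ_x u x·Σ_z K x z·u z| ≤ r·Σ_x u x²` (Schur test at the zero weight,
Cauchy–Schwarz). [folklore] -/
theorem kernel_form_le {ι : Type*} [Fintype ι] (K : ι → ι → ℝ) {r : ℝ} (hr : 0 ≤ r) (hrow : ∀ x, ∑ z, |K x z| ≤ r)
    (hcol : ∀ z, ∑ x, |K x z| ≤ r) (u : ι → ℝ) : |∑ x, u x * ∑ z, K x z * u z| ≤ r * ∑ x, u x ^ 2 := by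
  have hS := schur_test_weighted K (fun _ => (0 : ℝ)) u hr (fun x => by simpa using hrow x) (fun z => by simpa using hcol z)
  simp only [Real.exp_zero, one_mul] at hS
  have hu0 : 0 ≤ ∑ x, u x ^ 2 := Finset.sum_nonneg fun _ _ => sq_nonneg _
  have hCS := Real.sum_mul_le_sqrt_mul_sqrt Finset.univ u (fun x => ∑ z, K x z * u z)
  have hCS' := Real.sum_mul_le_sqrt_mul_sqrt Finset.univ (fun x => -u x) (fun x => ∑ z, K x z * u z)
  have hneg : ∑ x, (-u x) ^ 2 = ∑ x, u x ^ 2 := Finset.sum_congr rfl fun x _ => by ring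
  rw [hneg] at hCS'
  have h1 : √(∑ x, u x ^ 2) * √(∑ x, (∑ z, K x z * u z) ^ 2) ≤ √(∑ x, u x ^ 2) * (r * √(∑ x, u x ^ 2)) :=
    mul_le_mul_of_nonneg_left hS (Real.sqrt_nonneg _)
  have h2 : √(∑ x, u x ^ 2) * (r * √(∑ x, u x ^ 2)) = r * ∑ x, u x ^ 2 := by
    rw [mul_comm, mul_assoc, Real.mul_self_sqrt hu0]
  rw [abs_le]
  constructor
  · have : ∑ x, -u x * ∑ z, K x z * u z = -∑ x, u x * ∑ z, K x z * u z := by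
      rw [← Finset.sum_neg_distrib]; exact Finset.sum_congr rfl fun x _ => by ring
    rw [this] at hCS'
    linarith
  · linarith

/-- Linearity of the perturbed action over finite superpositions: `(H + K)(Σ_i c_i u_i) = Σ_i c_i (H + K)u_i`. [folklore] -/
theorem perturbed_action_sum_smul (n : ℕ) (a : ℝ) (s : ℕ) [NeZero s] {ι : Type*} (I : Finset ι) (c : ι → ℝ)
    (u : ι → Site d ((n + 1) * s) → ℝ) (V : Site d ((n + 1) * s) → ℝ) (K : Site d ((n + 1) * s) → Site d ((n + 1) * s) → ℝ)
    (x : Site d ((n + 1) * s)) :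
    ((n : ℝ) + 1) ^ 2 * ∑ μ, (2 * (∑ i ∈ I, c i * u i x) - (∑ i ∈ I, c i * u i (x + siteOf d ((n + 1) * s) (e μ)))
          - (∑ i ∈ I, c i * u i (x - siteOf d ((n + 1) * s) (e μ))))
        + a / ((n : ℝ) + 1) ^ d * ∑ q ∈ B n (blk n (windowMap d ((n + 1) * s) x)), (∑ i ∈ I, c i * u i (siteOf d ((n + 1) * s) q))
        + V x * (∑ i ∈ I, c i * u i x) + ∑ z, K x z * (∑ i ∈ I, c i * u i z)
      = ∑ i ∈ I, c i * (((n : ℝ) + 1) ^ 2 * ∑ μ, (2 * u i x - u i (x + siteOf d ((n + 1) * s) (e μ)) - u i (x - siteOf d ((n + 1) * s) (e μ)))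
        + a / ((n : ℝ) + 1) ^ d * ∑ q ∈ B n (blk n (windowMap d ((n + 1) * s) x)), u i (siteOf d ((n + 1) * s) q) + V x * u i x
        + ∑ z, K x z * u i z) := by
  rw [action_sum_smul n a s I c u V x]
  have hK : ∑ z, K x z * (∑ i ∈ I, c i * u i z) = ∑ i ∈ I, c i * ∑ z, K x z * u i z := by
    calc ∑ z, K x z * (∑ i ∈ I, c i * u i z) = ∑ z, ∑ i ∈ I, c i * (K x z * u i z) :=
          Finset.sum_congr rfl fun z _ => by rw [Finset.mul_sum]; exact Finset.sum_congr rfl fun i _ => by ring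
      _ = ∑ i ∈ I, ∑ z, c i * (K x z * u i z) := Finset.sum_comm
      _ = _ := Finset.sum_congr rfl fun i _ => (Finset.mul_sum _ _ _).symm
  rw [hK, ← Finset.sum_add_distrib]
  exact Finset.sum_congr rfl fun i _ => by ring

/-! ## §2. The variational inequality for `H + K` -/

section Variational

variable (n : ℕ) (a : ℝ) (s : ℕ) [NeZero s]

/-- **THE VARIATIONAL INEQUALITY FOR `H + K`**: `(H + K)Ψ = G`, `V ≥ −λ`, `K` symmetric with row and column sums `≤ r`, `λ + r ≤ min(2,a)` ⟹
for every test function `Φ` and `t`: `2tΣGΦ − t²ΣΦ·(H+K)Φ ≤ ΣGΨ`. [folklore] -/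
theorem perturbed_variational (V Ψ G Φ : Site d ((n + 1) * s) → ℝ) (K : Site d ((n + 1) * s) → Site d ((n + 1) * s) → ℝ)
    {lam r : ℝ} (hr : 0 ≤ r) (hlam : lam + r ≤ min 2 a) (hV : ∀ x, -lam ≤ V x) (hKs : ∀ x z, K x z = K z x)
    (hrow : ∀ x, ∑ z, |K x z| ≤ r) (hcol : ∀ z, ∑ x, |K x z| ≤ r)
    (hΨ : ∀ x, ((n : ℝ) + 1) ^ 2 * ∑ μ, (2 * Ψ x - Ψ (x + siteOf d ((n + 1) * s) (e μ)) - Ψ (x - siteOf d ((n + 1) * s) (e μ)))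
      + a / ((n : ℝ) + 1) ^ d * ∑ q ∈ B n (blk n (windowMap d ((n + 1) * s) x)), Ψ (siteOf d ((n + 1) * s) q) + V x * Ψ x
      + ∑ z, K x z * Ψ z = G x)
    (t : ℝ) :
    2 * t * ∑ x, G x * Φ x - t ^ 2 * ∑ x, Φ x * (((n : ℝ) + 1) ^ 2 * ∑ μ, (2 * Φ x - Φ (x + siteOf d ((n + 1) * s) (e μ))
        - Φ (x - siteOf d ((n + 1) * s) (e μ))) + a / ((n : ℝ) + 1) ^ d * ∑ q ∈ B n (blk n (windowMap d ((n + 1) * s) x)),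
          Φ (siteOf d ((n + 1) * s) q) + V x * Φ x + ∑ z, K x z * Φ z)
      ≤ ∑ x, G x * Ψ x := by
  set D : Site d ((n + 1) * s) → ℝ := fun x => Ψ x - t * Φ x with hD
  -- the floor of the perturbed form on `D`
  have hfloor : 0 ≤ ∑ x, D x * (((n : ℝ) + 1) ^ 2 * ∑ μ, (2 * D x - D (x + siteOf d ((n + 1) * s) (e μ)) - D (x - siteOf d ((n + 1) * s) (e μ)))
      + a / ((n : ℝ) + 1) ^ d * ∑ q ∈ B n (blk n (windowMap d ((n + 1) * s) x)), D (siteOf d ((n + 1) * s) q) + V x * D x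
      + ∑ z, K x z * D z) := by
    have hc := torus_form_coercive_explicit n a s D
    have hVD : -lam * ∑ x, D x ^ 2 ≤ ∑ x, V x * D x ^ 2 := by
      rw [Finset.mul_sum]; exact Finset.sum_le_sum fun x _ => mul_le_mul_of_nonneg_right (hV x) (sq_nonneg _)
    have hKD : -(r * ∑ x, D x ^ 2) ≤ ∑ x, D x * ∑ z, K x z * D z := (abs_le.1 (kernel_form_le K hr hrow hcol D)).1
    have hS : 0 ≤ ∑ x, D x ^ 2 := Finset.sum_nonneg fun _ _ => sq_nonneg _
    have hsplit : ∑ x, D x * (((n : ℝ) + 1) ^ 2 * ∑ μ, (2 * D x - D (x + siteOf d ((n + 1) * s) (e μ)) - D (x - siteOf d ((n + 1) * s) (e μ)))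
          + a / ((n : ℝ) + 1) ^ d * ∑ q ∈ B n (blk n (windowMap d ((n + 1) * s) x)), D (siteOf d ((n + 1) * s) q) + V x * D x
          + ∑ z, K x z * D z)
        = ∑ x, D x * (((n : ℝ) + 1) ^ 2 * ∑ μ, (2 * D x - D (x + siteOf d ((n + 1) * s) (e μ)) - D (x - siteOf d ((n + 1) * s) (e μ)))
          + a / ((n : ℝ) + 1) ^ d * ∑ q ∈ B n (blk n (windowMap d ((n + 1) * s) x)), D (siteOf d ((n + 1) * s) q))
          + ∑ x, V x * D x ^ 2 + ∑ x, D x * ∑ z, K x z * D z := by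
      rw [← Finset.sum_add_distrib, ← Finset.sum_add_distrib]; exact Finset.sum_congr rfl fun x _ => by ring
    rw [hsplit]
    have hmin : (lam + r) * ∑ x, D x ^ 2 ≤ min 2 a * ∑ x, D x ^ 2 := mul_le_mul_of_nonneg_right hlam hS
    nlinarith
  -- `(H+K)D = G − t·(H+K)Φ`
  have hHD : ∀ x, ((n : ℝ) + 1) ^ 2 * ∑ μ, (2 * D x - D (x + siteOf d ((n + 1) * s) (e μ)) - D (x - siteOf d ((n + 1) * s) (e μ)))
      + a / ((n : ℝ) + 1) ^ d * ∑ q ∈ B n (blk n (windowMap d ((n + 1) * s) x)), D (siteOf d ((n + 1) * s) q) + V x * D x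
      + ∑ z, K x z * D z
      = G x - t * (((n : ℝ) + 1) ^ 2 * ∑ μ, (2 * Φ x - Φ (x + siteOf d ((n + 1) * s) (e μ)) - Φ (x - siteOf d ((n + 1) * s) (e μ)))
        + a / ((n : ℝ) + 1) ^ d * ∑ q ∈ B n (blk n (windowMap d ((n + 1) * s) x)), Φ (siteOf d ((n + 1) * s) q) + V x * Φ x
        + ∑ z, K x z * Φ z) := by
    intro x
    simp only [hD]
    rw [perturbed_action_sub n a s V K Ψ (fun x => t * Φ x) x, hΨ x, perturbed_action_smul n a s V K Φ t x]
  -- the cross term by symmetry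
  have hcross := perturbed_form_symm n a s V K hKs Φ Ψ
  simp only [hΨ] at hcross
  have hexp : ∑ x, D x * (G x - t * (((n : ℝ) + 1) ^ 2 * ∑ μ, (2 * Φ x - Φ (x + siteOf d ((n + 1) * s) (e μ)) - Φ (x - siteOf d ((n + 1) * s) (e μ)))
        + a / ((n : ℝ) + 1) ^ d * ∑ q ∈ B n (blk n (windowMap d ((n + 1) * s) x)), Φ (siteOf d ((n + 1) * s) q) + V x * Φ x
        + ∑ z, K x z * Φ z))
      = ∑ x, G x * Ψ x - t * ∑ x, G x * Φ x
        - t * ∑ x, Ψ x * (((n : ℝ) + 1) ^ 2 * ∑ μ, (2 * Φ x - Φ (x + siteOf d ((n + 1) * s) (e μ)) - Φ (x - siteOf d ((n + 1) * s) (e μ)))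
          + a / ((n : ℝ) + 1) ^ d * ∑ q ∈ B n (blk n (windowMap d ((n + 1) * s) x)), Φ (siteOf d ((n + 1) * s) q) + V x * Φ x
          + ∑ z, K x z * Φ z)
        + t ^ 2 * ∑ x, Φ x * (((n : ℝ) + 1) ^ 2 * ∑ μ, (2 * Φ x - Φ (x + siteOf d ((n + 1) * s) (e μ)) - Φ (x - siteOf d ((n + 1) * s) (e μ)))
          + a / ((n : ℝ) + 1) ^ d * ∑ q ∈ B n (blk n (windowMap d ((n + 1) * s) x)), Φ (siteOf d ((n + 1) * s) q) + V x * Φ x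
          + ∑ z, K x z * Φ z) := by
    simp only [hD, Finset.mul_sum, ← Finset.sum_sub_distrib, ← Finset.sum_add_distrib]
    exact Finset.sum_congr rfl fun x _ => by ring
  simp only [hHD] at hfloor
  rw [hexp, hcross] at hfloor
  have hsym : ∑ x, Φ x * G x = ∑ x, G x * Φ x := Finset.sum_congr rfl fun x _ => mul_comm _ _
  rw [hsym] at hfloor
  linarith

end Variational

/-! ## §3. The coarse floor for `H + K` -/

section Floor

variable (n : ℕ) (a : ℝ) (s : ℕ) [NeZero s] (ha : 0 < a) {lam Lam ε γ : ℝ} (hLam : 0 ≤ Lam) (hε : 0 ≤ ε) (hγ : 0 < γ)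
  (hlam : lam + ε * (2 * (1 - exp (-γ))⁻¹) ^ d ≤ min 2 a)
  (V : Site d ((n + 1) * s) → ℝ) (hV : ∀ x, -lam ≤ V x) (hV' : ∀ x, V x ≤ Lam)
  (K : Site d ((n + 1) * s) → Site d ((n + 1) * s) → ℝ) (hKs : ∀ x z, K x z = K z x)
  (hK : ∀ x z, |K x z| ≤ ε * exp (-(γ * ∑ i, (((x i - z i).valMinAbs.natAbs : ℕ) : ℝ))))
  (ψ : Site d s → Site d ((n + 1) * s) → ℝ)
  (hψ : ∀ y' x, ((n : ℝ) + 1) ^ 2 * ∑ μ, (2 * ψ y' x - ψ y' (x + siteOf d ((n + 1) * s) (e μ)) - ψ y' (x - siteOf d ((n + 1) * s) (e μ)))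
      + a / ((n : ℝ) + 1) ^ d * ∑ q ∈ B n (blk n (windowMap d ((n + 1) * s) x)), ψ y' (siteOf d ((n + 1) * s) q) + V x * ψ y' x
      + ∑ z, K x z * ψ y' z = if siteOf d s (blk n (windowMap d ((n + 1) * s) x)) = y' then 1 else 0)

include ha hLam hε hγ hlam hV hV' hKs hK hψ in
/-- **THE COARSE FLOOR FOR `H + K`**: `Σ_y g y² ∕ (36^d(4d + a + Λ + εK_γ)) ≤ Σ_y g y·Σ_{y′} T_K(y,y′) g y′` for EVERY coarse `g` — (135)'s
variational argument with the bump test function; the kernel adds `εK_γ` to the test function's form. [folklore] -/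
theorem perturbed_coarse_floor (g : Site d s → ℝ) :
    1 / ((36 : ℝ) ^ d * (4 * d + a + Lam + ε * (2 * (1 - exp (-γ))⁻¹) ^ d)) * ∑ y, g y ^ 2
      ≤ ∑ y, g y * ∑ y', ((((n : ℝ) + 1) ^ d)⁻¹ * ∑ z : Fin d → Fin (n + 1), ψ y' (siteOf d ((n + 1) * s) (chart n (windowMap d s y) z))) * g y' := by
  classical
  have hvol : (0 : ℝ) < ((n : ℝ) + 1) ^ d := by positivity
  have hn : (0 : ℝ) < (n : ℝ) + 1 := by positivity
  have hd : (0 : ℝ) ≤ d := Nat.cast_nonneg d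
  set r : ℝ := ε * (2 * (1 - exp (-γ))⁻¹) ^ d with hr_def
  have hr : 0 ≤ r := mul_nonneg hε (pow_nonneg (mul_nonneg zero_le_two (inv_nonneg.2 (sub_nonneg.2 (exp_le_one_iff.2 (by linarith))))) d)
  have hrow : ∀ x, ∑ z, |K x z| ≤ r := rowsum_le ((n + 1) * s) K hε hK hγ
  have hcol : ∀ z, ∑ x, |K x z| ≤ r := colsum_le ((n + 1) * s) K hε hK hγ
  set Ψ : Site d ((n + 1) * s) → ℝ := fun x => ∑ y', g y' * ψ y' x with hΨdef
  set Fb : Site d ((n + 1) * s) → ℝ := fun x => F n (fun q => g (siteOf d s q)) (windowMap d ((n + 1) * s) x) with hFb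
  -- (P1) `(H+K)Ψ = g ∘ bt`
  have hΨ : ∀ x, ((n : ℝ) + 1) ^ 2 * ∑ μ, (2 * Ψ x - Ψ (x + siteOf d ((n + 1) * s) (e μ)) - Ψ (x - siteOf d ((n + 1) * s) (e μ)))
      + a / ((n : ℝ) + 1) ^ d * ∑ q ∈ B n (blk n (windowMap d ((n + 1) * s) x)), Ψ (siteOf d ((n + 1) * s) q) + V x * Ψ x
      + ∑ z, K x z * Ψ z = g (siteOf d s (blk n (windowMap d ((n + 1) * s) x))) := by
    intro x
    simp only [hΨdef]
    rw [perturbed_action_sum_smul n a s Finset.univ g ψ V K x]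
    simp only [hψ, mul_ite, mul_one, mul_zero]
    rw [Finset.sum_ite_eq, if_pos (Finset.mem_univ _)]
  -- (P2) the coarse form is `vol⁻¹·Σ_x g(bt x)·Ψ x`
  have hform : ∑ y, g y * ∑ y', ((((n : ℝ) + 1) ^ d)⁻¹
        * ∑ z : Fin d → Fin (n + 1), ψ y' (siteOf d ((n + 1) * s) (chart n (windowMap d s y) z))) * g y'
      = (((n : ℝ) + 1) ^ d)⁻¹ * ∑ x, g (siteOf d s (blk n (windowMap d ((n + 1) * s) x))) * Ψ x := by
    rw [sum_blockLift_mul n s g Ψ, Finset.mul_sum]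
    refine Finset.sum_congr rfl fun y _ => ?_
    rw [sum_B (windowMap d s y) (fun p => Ψ (siteOf d ((n + 1) * s) p))]
    have hin : ∑ y', ((((n : ℝ) + 1) ^ d)⁻¹
          * ∑ z : Fin d → Fin (n + 1), ψ y' (siteOf d ((n + 1) * s) (chart n (windowMap d s y) z))) * g y'
        = (((n : ℝ) + 1) ^ d)⁻¹ * ∑ z : Fin d → Fin (n + 1), ∑ y', g y' * ψ y' (siteOf d ((n + 1) * s) (chart n (windowMap d s y) z)) := by
      calc ∑ y', ((((n : ℝ) + 1) ^ d)⁻¹ * ∑ z : Fin d → Fin (n + 1), ψ y' (siteOf d ((n + 1) * s) (chart n (windowMap d s y) z))) * g y'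
          = ∑ y', ∑ z : Fin d → Fin (n + 1), (((n : ℝ) + 1) ^ d)⁻¹ * (g y' * ψ y' (siteOf d ((n + 1) * s) (chart n (windowMap d s y) z))) :=
            Finset.sum_congr rfl fun y' _ => by
              rw [mul_comm, ← mul_assoc, Finset.mul_sum]
              exact Finset.sum_congr rfl fun z _ => by ring
        _ = ∑ z : Fin d → Fin (n + 1), ∑ y', (((n : ℝ) + 1) ^ d)⁻¹ * (g y' * ψ y' (siteOf d ((n + 1) * s) (chart n (windowMap d s y) z))) :=
            Finset.sum_comm
        _ = _ := by
            rw [Finset.mul_sum]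
            exact Finset.sum_congr rfl fun z _ => (Finset.mul_sum _ _ _).symm
    rw [hin]
    simp only [hΨdef]
    ring
  -- (P3) variational inequality with `t₀ = 6^{−d}∕D′`, `D′ = 4d + a + Λ + r`
  have hlam' : lam + r ≤ min 2 a := hlam
  set t₀ : ℝ := (1 / 6 : ℝ) ^ d / (4 * d + a + Lam + r) with ht₀
  have ht₀0 : 0 ≤ t₀ := by positivity
  have hvar := perturbed_variational n a s V Ψ (fun x => g (siteOf d s (blk n (windowMap d ((n + 1) * s) x)))) Fb K hr hlam' hV hKs hrow hcol hΨ t₀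
  -- (P4) the pairing; (P5) the form of the test function
  have hpair : ∑ x, g (siteOf d s (blk n (windowMap d ((n + 1) * s) x))) * Fb x = Theta1 n ^ d * ∑ y, g y ^ 2 := sum_blockLift_mul_F n s g
  have hsplit := torus_form_split n a s Fb
  have hL : ((n : ℝ) + 1) ^ 2 * ∑ μ : Fin d, ∑ x, (Fb (x + siteOf d ((n + 1) * s) (e μ)) - Fb x) ^ 2
      ≤ 4 * d * ((n : ℝ) + 1) ^ d * ∑ y, g y ^ 2 := by
    have h1 := Finset.sum_le_sum fun μ (_ : μ ∈ (Finset.univ : Finset (Fin d))) => sum_bond_sq_le n s g μ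
    rw [Finset.sum_const, Finset.card_univ, Fintype.card_fin, nsmul_eq_mul] at h1
    exact (mul_le_mul_of_nonneg_left h1 (by positivity)).trans (le_of_eq (by field_simp))
  have hB : a / ((n : ℝ) + 1) ^ d * ∑ y : Site d s, (∑ z : Fin d → Fin (n + 1), Fb (siteOf d ((n + 1) * s) (chart n (windowMap d s y) z))) ^ 2
      ≤ a * ((n : ℝ) + 1) ^ d * ∑ y, g y ^ 2 := by
    simp only [hFb, blockSum_F n s g, mul_pow, ← Finset.sum_mul]
    have hΘ : Theta1 n ^ d ≤ ((n : ℝ) + 1) ^ d := pow_le_pow_left₀ (Theta1_nonneg n) ((div_le_one hn).1 (Theta1_div_le n)) d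
    have hS : 0 ≤ ∑ y, g y ^ 2 := Finset.sum_nonneg fun _ _ => sq_nonneg _
    rw [div_mul_eq_mul_div, div_le_iff₀ hvol]
    have : (Theta1 n ^ d) ^ 2 ≤ ((n : ℝ) + 1) ^ d * ((n : ℝ) + 1) ^ d := by nlinarith [pow_nonneg (Theta1_nonneg n) d]
    nlinarith [mul_le_mul_of_nonneg_left this (mul_nonneg ha.le hS)]
  have hVt : ∑ x, V x * (Fb x * Fb x) ≤ Lam * ((n : ℝ) + 1) ^ d * ∑ y, g y ^ 2 := by
    have h1 : ∑ x, V x * (Fb x * Fb x) ≤ ∑ x, Lam * Fb x ^ 2 :=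
      Finset.sum_le_sum fun x _ => by rw [← sq]; exact mul_le_mul_of_nonneg_right (hV' x) (sq_nonneg _)
    rw [← Finset.mul_sum] at h1
    exact h1.trans (by rw [mul_assoc]; exact mul_le_mul_of_nonneg_left (sum_F_sq_le n s g) hLam)
  have hKt : ∑ x, Fb x * ∑ z, K x z * Fb z ≤ r * ((n : ℝ) + 1) ^ d * ∑ y, g y ^ 2 := by
    have h1 := (abs_le.1 (kernel_form_le K hr hrow hcol Fb)).2
    have h2 : r * ∑ x, Fb x ^ 2 ≤ r * (((n : ℝ) + 1) ^ d * ∑ y, g y ^ 2) := mul_le_mul_of_nonneg_left (sum_F_sq_le n s g) hr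
    linarith
  have hformF : ∑ x, Fb x * (((n : ℝ) + 1) ^ 2 * ∑ μ, (2 * Fb x - Fb (x + siteOf d ((n + 1) * s) (e μ))
        - Fb (x - siteOf d ((n + 1) * s) (e μ))) + a / ((n : ℝ) + 1) ^ d * ∑ q ∈ B n (blk n (windowMap d ((n + 1) * s) x)),
          Fb (siteOf d ((n + 1) * s) q) + V x * Fb x + ∑ z, K x z * Fb z)
      ≤ (4 * d + a + Lam + r) * ((n : ℝ) + 1) ^ d * ∑ y, g y ^ 2 := by
    have e : ∑ x, Fb x * (((n : ℝ) + 1) ^ 2 * ∑ μ, (2 * Fb x - Fb (x + siteOf d ((n + 1) * s) (e μ))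
        - Fb (x - siteOf d ((n + 1) * s) (e μ))) + a / ((n : ℝ) + 1) ^ d * ∑ q ∈ B n (blk n (windowMap d ((n + 1) * s) x)),
          Fb (siteOf d ((n + 1) * s) q) + V x * Fb x + ∑ z, K x z * Fb z)
      = ∑ x, Fb x * (((n : ℝ) + 1) ^ 2 * ∑ μ, (2 * Fb x - Fb (x + siteOf d ((n + 1) * s) (e μ))
        - Fb (x - siteOf d ((n + 1) * s) (e μ))) + a / ((n : ℝ) + 1) ^ d * ∑ q ∈ B n (blk n (windowMap d ((n + 1) * s) x)),
          Fb (siteOf d ((n + 1) * s) q)) + ∑ x, V x * (Fb x * Fb x) + ∑ x, Fb x * ∑ z, K x z * Fb z := by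
      rw [← Finset.sum_add_distrib, ← Finset.sum_add_distrib]; exact Finset.sum_congr rfl fun x _ => by ring
    rw [e, hsplit]
    linarith
  -- (P6) the scalar optimisation
  have hΘlo : ((n : ℝ) + 1) ^ d * (1 / 6 : ℝ) ^ d ≤ Theta1 n ^ d := by
    rw [← mul_pow]
    refine pow_le_pow_left₀ (by positivity) ?_ d
    have := Theta1_div_ge n; rw [le_div_iff₀ hn] at this; linarith
  have hS : 0 ≤ ∑ y, g y ^ 2 := Finset.sum_nonneg fun _ _ => sq_nonneg _
  set σ : ℝ := (1 / 6 : ℝ) ^ d with hσ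
  have hσσ : σ * σ = 1 / (36 : ℝ) ^ d := by rw [hσ, ← mul_pow, show (1 / 6 : ℝ) * (1 / 6) = 1 / 36 by norm_num, one_div_pow]
  rw [hpair] at hvar
  have h1 : 2 * t₀ * (((n : ℝ) + 1) ^ d * σ * ∑ y, g y ^ 2) ≤ 2 * t₀ * (Theta1 n ^ d * ∑ y, g y ^ 2) :=
    mul_le_mul_of_nonneg_left (mul_le_mul_of_nonneg_right hΘlo hS) (by positivity)
  have h2 := mul_le_mul_of_nonneg_left hformF (sq_nonneg t₀)
  have hD' : 0 < 4 * d + a + Lam + r := by positivity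
  have h3 : ((n : ℝ) + 1) ^ d * (1 / ((36 : ℝ) ^ d * (4 * d + a + Lam + r)) * ∑ y, g y ^ 2)
      = 2 * t₀ * (((n : ℝ) + 1) ^ d * σ * ∑ y, g y ^ 2) - t₀ ^ 2 * ((4 * d + a + Lam + r) * ((n : ℝ) + 1) ^ d * ∑ y, g y ^ 2) := by
    rw [show (1 : ℝ) / ((36 : ℝ) ^ d * (4 * d + a + Lam + r)) = σ * σ / (4 * d + a + Lam + r) by
      rw [← one_div_mul_one_div, ← hσσ]; ring, ht₀]
    field_simp
    ring
  have key : ((n : ℝ) + 1) ^ d * (1 / ((36 : ℝ) ^ d * (4 * d + a + Lam + r)) * ∑ y, g y ^ 2)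
      ≤ ∑ x, g (siteOf d s (blk n (windowMap d ((n + 1) * s) x))) * Ψ x := by
    rw [h3]; linarith
  rw [hform, inv_mul_eq_div]
  exact (le_div_iff₀' hvol).2 key

end Floor

/-! ## §4. THE END: the next-scale Hessian of `H + K` is exponentially local -/

/-- **HEADLINE — THE NEXT-SCALE HESSIAN OF THE PERTURBED ROAD IS EXPONENTIALLY LOCAL, UNCONDITIONALLY: the locality column ITERATES.**  Fix
`d`, `a > 0`, `λ < min(2,a)`, `Λ ≥ 0`, a kernel decay rate `γ > 1` and a kernel size `ε ≥ 0` with `ε·(2∕(1 − e^{−(γ−1)}))^d ≤ (min(2,a) − λ)∕4`.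
THERE ARE `c₁, δ₁ > 0` (functions of these only) such that for ALL `n, s`, ALL `−λ ≤ V ≤ Λ`, ALL symmetric kernels `|K(x,z)| ≤
εe^{−γρ_N(x,z)}` and their block columns `ψ^K` (`(H + K)ψ^K_{y′} = 𝟙[bt · = y′]`): `|T_K⁻¹(y,y′)| ≤ c₁e^{−δ₁ρ_s(y,y′)}` — §3's floor, (165)'s
symmetry and entry decay (at (131)'s rate `κ ≤ 1 < γ`), and [B4] Sect. 5 by name ((132) `coarse_inverse_decay`). [folklore] -/
theorem perturbed_nextScale_hessian_local (a : ℝ) (ha : 0 < a) {lam Lam ε γ : ℝ} (hm0 : 0 < min 2 a - lam) (hLam : 0 ≤ Lam)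
    (hε : 0 ≤ ε) (hγ : 1 < γ) (hεs : ε * (2 * (1 - exp (-(γ - 1)))⁻¹) ^ d ≤ (min 2 a - lam) / 4) :
    ∃ c₁ δ₁ : ℝ, 0 < c₁ ∧ 0 < δ₁ ∧ ∀ (n s : ℕ) [NeZero s] (V : Site d ((n + 1) * s) → ℝ), (∀ x, -lam ≤ V x) → (∀ x, V x ≤ Lam) →
      ∀ K : Site d ((n + 1) * s) → Site d ((n + 1) * s) → ℝ, (∀ x z, K x z = K z x) →
      (∀ x z, |K x z| ≤ ε * exp (-(γ * ∑ i, (((x i - z i).valMinAbs.natAbs : ℕ) : ℝ)))) →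
      ∀ ψ : Site d s → Site d ((n + 1) * s) → ℝ,
      (∀ y' x, ((n : ℝ) + 1) ^ 2 * ∑ μ, (2 * ψ y' x - ψ y' (x + siteOf d ((n + 1) * s) (e μ)) - ψ y' (x - siteOf d ((n + 1) * s) (e μ)))
        + a / ((n : ℝ) + 1) ^ d * ∑ q ∈ B n (blk n (windowMap d ((n + 1) * s) x)), ψ y' (siteOf d ((n + 1) * s) q) + V x * ψ y' x
        + ∑ z, K x z * ψ y' z = if siteOf d s (blk n (windowMap d ((n + 1) * s) x)) = y' then 1 else 0) →
      ∀ y y' : Site d s,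
        |(Matrix.of fun y y' : Site d s =>
            (((n : ℝ) + 1) ^ d)⁻¹ * ∑ z : Fin d → Fin (n + 1), ψ y' (siteOf d ((n + 1) * s) (chart n (windowMap d s y) z)))⁻¹ y y'|
          ≤ c₁ * exp (-(δ₁ * ∑ i, (((y i - y' i).valMinAbs.natAbs : ℕ) : ℝ))) := by
  have hd : (0 : ℝ) ≤ d := Nat.cast_nonneg d
  obtain ⟨κ, hκ0, hκ1, hκm⟩ := exists_rate (d := d) a ha.le hm0
  have hκγ : κ < γ := lt_of_le_of_lt hκ1 hγ
  -- the kernel sums at the two rates: `K_{γ−κ} ≤ K_{γ−1}` and `K_γ ≤ K_{γ−1}` (monotone in the rate)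
  have hKmono : ∀ {α β : ℝ}, 0 < α → α ≤ β → (2 * (1 - exp (-β))⁻¹) ^ d ≤ (2 * (1 - exp (-α))⁻¹) ^ d := by
    intro α β hα hαβ
    have h1 : 0 < 1 - exp (-α) := sub_pos.2 (exp_lt_one_iff.2 (by linarith))
    have h2 : 1 - exp (-α) ≤ 1 - exp (-β) := by linarith [exp_le_exp.2 (neg_le_neg hαβ)]
    have h3 : 0 < 1 - exp (-β) := lt_of_lt_of_le h1 h2
    exact pow_le_pow_left₀ (mul_nonneg zero_le_two (inv_nonneg.2 h3.le)) (mul_le_mul_of_nonneg_left (inv_anti₀ h1 h2) zero_le_two) d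
  have hr1 : ε * (2 * (1 - exp (-(γ - κ)))⁻¹) ^ d ≤ (min 2 a - lam) / 4 :=
    (mul_le_mul_of_nonneg_left (hKmono (by linarith) (by linarith)) hε).trans hεs
  have hr2 : ε * (2 * (1 - exp (-γ))⁻¹) ^ d ≤ (min 2 a - lam) / 4 :=
    (mul_le_mul_of_nonneg_left (hKmono (by linarith) (by linarith)) hε).trans hεs
  have hm : ε * (2 * (1 - exp (-(γ - κ)))⁻¹) ^ d < min 2 a - lam - 2 * d * κ ^ 2 - a * (exp (2 * d * κ) - 1) := by linarith
  have hfl : 0 < min 2 a - lam - 2 * d * κ ^ 2 - a * (exp (2 * d * κ) - 1) - ε * (2 * (1 - exp (-(γ - κ)))⁻¹) ^ d := by linarith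
  have hγ0 : 0 < 1 / ((36 : ℝ) ^ d * (4 * d + a + Lam + ε * (2 * (1 - exp (-γ))⁻¹) ^ d)) := by
    have hK0 : 0 ≤ ε * (2 * (1 - exp (-γ))⁻¹) ^ d :=
      mul_nonneg hε (pow_nonneg (mul_nonneg zero_le_two (inv_nonneg.2 (sub_nonneg.2 (exp_le_one_iff.2 (by linarith))))) d)
    have hD : 0 < 4 * (d : ℝ) + a + Lam + ε * (2 * (1 - exp (-γ))⁻¹) ^ d := add_pos_of_pos_of_nonneg (by positivity) hK0
    exact div_pos one_pos (mul_pos (pow_pos (by norm_num) d) hD)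
  have hc0 : 0 < (min 2 a - lam - 2 * d * κ ^ 2 - a * (exp (2 * d * κ) - 1) - ε * (2 * (1 - exp (-(γ - κ)))⁻¹) ^ d)⁻¹ * exp (2 * d * κ) :=
    mul_pos (inv_pos.2 hfl) (exp_pos _)
  obtain ⟨c₁, δ₁, hc₁, hδ₁, H⟩ := coarse_inverse_decay (d := d) hγ0 hc0 hκ0
  refine ⟨c₁, δ₁, hc₁, hδ₁, fun n s _ V hV hV' K hKs hK ψ hψ y y' => H s _ ?_ y y'⟩
  have hlam : lam + ε * (2 * (1 - exp (-γ))⁻¹) ^ d ≤ min 2 a := by linarith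
  refine ⟨?_, ?_, ?_⟩
  · exact Matrix.IsSymm.ext fun y y' => by simp only [Matrix.of_apply]; exact perturbed_schur_symm n a s V K ψ hψ hKs y' y
  · intro g
    have h := perturbed_coarse_floor n a s ha hLam hε (by linarith) hlam V hV hV' K hKs hK ψ hψ g
    simpa only [Matrix.mulVec, dotProduct, Matrix.of_apply] using h
  · intro y y'
    simpa only [Matrix.of_apply] using perturbed_schur_entry_le n a s ha.le hκ0.le hκ1 hκγ hε hm V hV K hK ψ hψ y y'

/-! ## §5. Toy -/

/-- Toy (`d = 0`, `a = 1`, `λ = 0`, `Λ = 1`, `γ = 2`, `ε = 0`): the constants exist. -/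
example : ∃ c₁ δ₁ : ℝ, 0 < c₁ ∧ 0 < δ₁ :=
  let ⟨c₁, δ₁, hc₁, hδ₁, _⟩ := perturbed_nextScale_hessian_local (d := 0) 1 one_pos (lam := 0) (Lam := 1) (ε := 0) (γ := 2)
    (by norm_num) zero_le_one le_rfl (by norm_num) (by norm_num)
  ⟨c₁, δ₁, hc₁, hδ₁⟩

end Summit.QuantumFields.BalabanUV.T4Continuum.NE7b.SupTorusPerturbedCoarseFloor
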